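import Mathlib.Data.Real.Basic
import Mathlib.Tactic.Linarith
import Mathlib.Tactic.Ring
import HarnessLib

/-!
# Row 37 across a cut vertex isolating its hub: the real-variable identity (route `PercNearOneGluingNoHeavy`, supports-only; prim-l12-p6 g16)

Pure-real lemma behind `sahiE3_row37_nonneg_of_threeOneCut_a` (`…FrontierDecRowsRow37ThreeOneCutA`): Sahi's functional of the glued row 37
equals `(1−r)³·R43 + r(1−r)²·(R19+R19+R19) + r²(1−r)·(R15+R15+R15) + r³·R37` in the atoms of the near side (`r = P(h ↔ a)`), so it is
non-negative when the eight rows are.  Memo `run/shared/lean/prim/prim-l12/FROM-prim-l12-p6-g16-ROW37-HUB-IDENTITY.md` §1.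
No definitions, no named facts, no sorries.
-/

namespace Summit.CriticalPhenomena.PercolationContinuityZ3.Theorems.FrontierDecRows

/-- The row-37 hub identity in real variables (atoms of the near side; `r = P(h ↔ a)`), with the linking equations of the
restricted sets as hypotheses; conclusion = Sahi's functional of the glued row. [this work] -/
theorem row37_threeOneCutA_ineq
    (r bc cy by3 bcHc cyHy byHb bccy bcby cyby all3 u1 u2 v1 v2 w1 w2 tc ty tb
      A1 A2 A3 A4 B1 B2 B3 B4 G1 G2 G3 G4 C1 C2 D1 D2 E1 E2 F1 : ℝ)
    (hr0 : 0 ≤ r) (hr1 : r ≤ 1)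
    (hA1 : A1 = all3 - tc) (hA2 : A2 = bc - bcHc) (hA3 : A3 = bccy - u1) (hA4 : A4 = bcby - v1)
    (hB1 : B1 = all3 - ty) (hB2 : B2 = cy - cyHy) (hB3 : B3 = cyby - w1) (hB4 : B4 = bccy - u2)
    (hG1 : G1 = all3 - tb) (hG2 : G2 = by3 - byHb) (hG3 : G3 = bcby - v2) (hG4 : G4 = cyby - w2)
    (hC1 : C1 = all3 - (tc + ty)) (hC2 : C2 = bccy - (u1 + u2))
    (hD1 : D1 = all3 - (ty + tb)) (hD2 : D2 = cyby - (w1 + w2))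
    (hE1 : E1 = all3 - (tb + tc)) (hE2 : E2 = bcby - (v1 + v2))
    (hF1 : F1 = all3 - (tc + ty + tb))
    (h43 : 0 ≤ 2 * all3 + bc * by3 * cy - (bc * cyby + by3 * bccy + cy * bcby))
    (h19a : 0 ≤ 2 * A1 + A2 * by3 * cy - (A2 * cyby + by3 * A3 + cy * A4))
    (h19b : 0 ≤ 2 * B1 + B2 * bc * by3 - (B2 * bcby + bc * B3 + by3 * B4))
    (h19c : 0 ≤ 2 * G1 + G2 * cy * bc - (G2 * bccy + cy * G3 + bc * G4))
    (h15a : 0 ≤ 2 * C1 + A2 * B2 * by3 - (A2 * B3 + B2 * A4 + by3 * C2))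
    (h15b : 0 ≤ 2 * D1 + B2 * G2 * bc - (B2 * G3 + G2 * B4 + bc * D2))
    (h15c : 0 ≤ 2 * E1 + G2 * A2 * cy - (G2 * A3 + A2 * G4 + cy * E2))
    (h37 : 0 ≤ 2 * F1 + A2 * B2 * G2 - (A2 * D2 + B2 * E2 + G2 * C2)) :
    0 ≤ 2 * (all3 - (tc + ty + tb) * r) + (bc - bcHc * r) * (cy - cyHy * r) * (by3 - byHb * r) -
      ((bc - bcHc * r) * (cyby - (w1 + w2) * r) + (cy - cyHy * r) * (bcby - (v1 + v2) * r) +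
        (by3 - byHb * r) * (bccy - (u1 + u2) * r)) := by
  subst hA1 hA2 hA3 hA4 hB1 hB2 hB3 hB4 hG1 hG2 hG3 hG4 hC1 hC2 hD1 hD2 hE1 hE2 hF1
  have key : 2 * (all3 - (tc + ty + tb) * r) + (bc - bcHc * r) * (cy - cyHy * r) * (by3 - byHb * r) -
      ((bc - bcHc * r) * (cyby - (w1 + w2) * r) + (cy - cyHy * r) * (bcby - (v1 + v2) * r) +
        (by3 - byHb * r) * (bccy - (u1 + u2) * r)) =
      (1 - r) ^ 3 * (2 * all3 + bc * by3 * cy - (bc * cyby + by3 * bccy + cy * bcby)) +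
      r * (1 - r) ^ 2 * ((2 * (all3 - tc) + (bc - bcHc) * by3 * cy - ((bc - bcHc) * cyby + by3 * (bccy - u1) + cy * (bcby - v1))) +
        (2 * (all3 - ty) + (cy - cyHy) * bc * by3 - ((cy - cyHy) * bcby + bc * (cyby - w1) + by3 * (bccy - u2))) +
        (2 * (all3 - tb) + (by3 - byHb) * cy * bc - ((by3 - byHb) * bccy + cy * (bcby - v2) + bc * (cyby - w2)))) +
      r ^ 2 * (1 - r) * ((2 * (all3 - (tc + ty)) + (bc - bcHc) * (cy - cyHy) * by3 -
          ((bc - bcHc) * (cyby - w1) + (cy - cyHy) * (bcby - v1) + by3 * (bccy - (u1 + u2)))) +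
        (2 * (all3 - (ty + tb)) + (cy - cyHy) * (by3 - byHb) * bc -
          ((cy - cyHy) * (bcby - v2) + (by3 - byHb) * (bccy - u2) + bc * (cyby - (w1 + w2)))) +
        (2 * (all3 - (tb + tc)) + (by3 - byHb) * (bc - bcHc) * cy -
          ((by3 - byHb) * (bccy - u1) + (bc - bcHc) * (cyby - w2) + cy * (bcby - (v1 + v2))))) +
      r ^ 3 * (2 * (all3 - (tc + ty + tb)) + (bc - bcHc) * (cy - cyHy) * (by3 - byHb) -
        ((bc - bcHc) * (cyby - (w1 + w2)) + (cy - cyHy) * (bcby - (v1 + v2)) + (by3 - byHb) * (bccy - (u1 + u2)))) := by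
    ring
  rw [key]
  have h1r : 0 ≤ 1 - r := sub_nonneg.2 hr1
  have t1 := mul_nonneg (pow_nonneg h1r 3) h43
  have t2 := mul_nonneg (mul_nonneg hr0 (pow_nonneg h1r 2)) (add_nonneg (add_nonneg h19a h19b) h19c)
  have t3 := mul_nonneg (mul_nonneg (sq_nonneg r) h1r) (add_nonneg (add_nonneg h15a h15b) h15c)
  have t4 := mul_nonneg (pow_nonneg hr0 3) h37
  linarith


end Summit.CriticalPhenomena.PercolationContinuityZ3.Theorems.FrontierDecRows
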